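import Summits.HodgeConjecture.HodgeConjecture.Theses.HolomorphicityRate
import Summits.HodgeConjecture.HodgeConjecture.Theorems.NikulinTwinTransportLefschetzOneOneK3Holomorphy
import Literature.AlgebraicGeometry.HodgeTheory.MiddleDimensionReductionOfHodgeModels

/-!
# Route HolomorphicityRate — `ThresholdForcesHodgeType` (item stmt-HodgeConjecture-10764) in the
# extreme codimensions `p = 0` and `p = n`

The support item `ThresholdForcesHodgeType` (E2 of the card *holomorphicity-rate-threshold*) says:
for `X` smooth projective of dimension `n`, `p ≤ n`, a Hodge model `A`, a smooth metric `g`, classes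
`c, hp ∈ H²ᵖ(X(ℂ); ℂ)` (`hp` rational algebraic), `m ≥ 1`, `a_k ≤ C kᵖ` and defects `t_k` with
`t_k kᵖ → 0`, if for infinitely many `k` the ray class `m•c + a_k•hp` is supported on a nearly
holomorphic cycle support of defect `≤ t_k`, then `A^* c ∈ H^{p,p}(A)`.

This helper file settles the two EXTREME codimensions, where the conclusion holds for every class
and the analytic hypotheses are not needed:

* `p = 0`: every class of `H⁰` is of type `(0, 0)` — a `0`-form has no arguments to rotate, so
  every closed `0`-form is of type `(0, 0)` (`hodgePQ_zero_eq_top`, from the tree's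
  `isOfType_zero_zero` of `Theorems/NikulinTwinTransportLefschetzOneOneK3Holomorphy`);
* `p = n`: every class of top degree `H²ⁿ` is of type `(n, n)` — the tree's
  `Literature.AlgebraicGeometry.HodgeTheory.hodgePQ_two_mul_finrank_eq_top` (the unit circle acts
  trivially on top-degree real-alternating forms; Voisin I, §2.3.1).

Hence `ThresholdForcesHodgeType` holds outright whenever `n ≤ 1` (points and curves:
`thresholdForcesHodgeType_of_le_one`), and in general the item is reduced to the middle range
`0 < p < n`, where the geometric-measure-theoretic content (Thom class of the support, smallness of
off-type periods on nearly complex planes, Wirtinger's inequality, Serre duality) lives.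

Nothing here is conditional: no named fact is used.
-/

-- `Summit.HodgeConjecture.HodgeConjecture.Theorems` is the mandated namespace (single-problem summit:
-- Problem = Summit), which `linter.dupNamespace` flags on every declaration; the lakefile turns the
-- linter off tree-wide (weak option), restated here so stand-alone elaboration is warning-free too.
set_option linter.dupNamespace false

namespace Summit.HodgeConjecture.HodgeConjecture.Theorems

open scoped Manifold ContDiff Topology
open Filter Set
open Literature.AlgebraicGeometry.HodgeTheory Literature.NumberTheory.Transcendental

/-! ### `H^{0,0}_dR = H⁰_dR` and `H^{n,n}_dR = H^{2n}_dR` -/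

/-- **`H^{0,0}_dR(M) = H⁰_dR(M)`**: every complex de Rham class of degree `0` is the class of a closed
`0`-form, which is of type `(0, 0)` (the tree's `isOfType_zero_zero`, Theorems file
`NikulinTwinTransportLefschetzOneOneK3Holomorphy`). [folklore] -/
theorem hodgePQ_zero_eq_top {E : Type} [NormedAddCommGroup E] [NormedSpace ℂ E]
    {M : Type} [TopologicalSpace M] [ChartedSpace E M] :
    hodgePQ E M 0 0 0 = ⊤ := by
  refine eq_top_iff.mpr fun u _ ↦ ?_
  obtain ⟨β, rfl⟩ := complexDeRhamCohomology.mk_surjective (E := E) (M := M) (k := 0) u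
  exact Submodule.subset_span ⟨β, isOfType_zero_zero _, rfl⟩

/-- In a Hodge model, **every class of degree `0` is of type `(0, 0)`**: `A.hodgePQ 0 0 0 = ⊤`
(image of `⊤` under the comparison equivalence). [folklore] -/
theorem hodgeModel_hodgePQ_zero_eq_top {n : ℕ} {X : Literature.AlgebraicGeometry.Motives.SchemeOver ℂ}
    (A : HodgeModel n X) : A.hodgePQ 0 0 0 = ⊤ := by
  change (hodgePQ A.model A.carrier 0 0 0).map (A.deRham A.carrier 0).toLinearMap = ⊤
  rw [hodgePQ_zero_eq_top, Submodule.map_top, LinearEquiv.range]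

/-- In a Hodge model of an `n`-dimensional `X`, **every class of top degree `2n` is of type
`(n, n)`**: `A.hodgePQ (2n) n n = ⊤` (the model space has complex dimension `n`,
`IsAnalytification.finrank_eq`, and `hodgePQ_two_mul_finrank_eq_top`).
[cite: VoisinHodgeI2002, §2.3.1 and §6.1] -/
theorem hodgeModel_hodgePQ_two_mul_eq_top {n : ℕ} {X : Literature.AlgebraicGeometry.Motives.SchemeOver ℂ}
    (A : HodgeModel n X) : A.hodgePQ (2 * n) n n = ⊤ := by
  change (hodgePQ A.model A.carrier (2 * n) n n).map (A.deRham A.carrier (2 * n)).toLinearMap = ⊤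
  rw [hodgePQ_two_mul_finrank_eq_top (M := A.carrier) A.isAnalytification.finrank_eq,
    Submodule.map_top, LinearEquiv.range]

/-! ### The item in the extreme codimensions -/

/-- **`ThresholdForcesHodgeType` for `p = 0`** (in the exact binder shape of the item, specialised to
`p = 0`): the conclusion `A^* c ∈ H^{0,0}` holds for every class `c ∈ H⁰(X(ℂ); ℂ)`, whatever the
ray data, since `H^{0,0} = H⁰` in any Hodge model (`hodgeModel_hodgePQ_zero_eq_top`). [folklore] -/
theorem thresholdForcesHodgeType_zero (n : ℕ) (X : Literature.AlgebraicGeometry.Motives.SchemeOver ℂ)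
    (A : HodgeModel n X) (c : complexBetti X (2 * 0)) :
    A.pullback (2 * 0) c ∈ A.hodgePQ (2 * 0) 0 0 := by
  have h : A.hodgePQ (2 * 0) 0 0 = ⊤ := hodgeModel_hodgePQ_zero_eq_top A
  rw [h]
  exact Submodule.mem_top

/-- **`ThresholdForcesHodgeType` for `p = n`** (top codimension): the conclusion `A^* c ∈ H^{n,n}`
holds for every class `c ∈ H²ⁿ(X(ℂ); ℂ)`, whatever the ray data, since every top-degree class is
of type `(n, n)` (`hodgeModel_hodgePQ_two_mul_eq_top`). [cite: VoisinHodgeI2002, §2.3.1 and §6.1] -/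
theorem thresholdForcesHodgeType_top (n : ℕ) (X : Literature.AlgebraicGeometry.Motives.SchemeOver ℂ)
    (A : HodgeModel n X) (c : complexBetti X (2 * n)) :
    A.pullback (2 * n) c ∈ A.hodgePQ (2 * n) n n := by
  rw [hodgeModel_hodgePQ_two_mul_eq_top A]
  exact Submodule.mem_top

/-- **The conclusion of `ThresholdForcesHodgeType` in the extreme codimensions**: for `p = 0` or
`p = n`, every class `c ∈ H²ᵖ(X(ℂ); ℂ)` satisfies `A^* c ∈ H^{p,p}(A)` (no hypothesis on `X`, `c`
or the ray is needed). [cite: VoisinHodgeI2002, §2.3.1 and §6.1] -/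
theorem pullback_mem_hodgePQ_of_eq_zero_or_eq {n p : ℕ}
    {X : Literature.AlgebraicGeometry.Motives.SchemeOver ℂ} (A : HodgeModel n X) (hp : p = 0 ∨ p = n)
    (c : complexBetti X (2 * p)) : A.pullback (2 * p) c ∈ A.hodgePQ (2 * p) p p := by
  rcases hp with rfl | rfl
  · exact thresholdForcesHodgeType_zero n X A c
  · exact thresholdForcesHodgeType_top p X A c

/-- **`ThresholdForcesHodgeType` holds for `n ≤ 1`** (points and curves), in the item's own words:
the route decl `ThresholdForcesHodgeType` with its leading `∀ n` restricted to `n ≤ 1`. For `p ≤ n ≤ 1`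
either `p = 0` or `p = n`, and `pullback_mem_hodgePQ_of_eq_zero_or_eq` applies; none of the ray
hypotheses is used. [cite: VoisinHodgeI2002, §2.3.1 and §6.1] -/
theorem thresholdForcesHodgeType_of_le_one (n : ℕ) (hn : n ≤ 1) (p : ℕ)
    (X : Literature.AlgebraicGeometry.Motives.SchemeOver ℂ)
    (_hX : Literature.AlgebraicGeometry.Motives.IsSmoothProjective n X) (hp : p ≤ n)
    (A : HodgeModel n X)
    (g : Bundle.ContMDiffRiemannianMetric 𝓘(ℝ, A.model) ((⊤ : ℕ∞) : WithTop ℕ∞) A.model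
      (fun x : A.carrier => TangentSpace 𝓘(ℝ, A.model) x))
    (c hp' : complexBetti X (2 * p)) (m : ℕ) (C : ℝ) (a : ℕ → ℕ) (t : ℕ → ℝ)
    (_hrat : IsRationalClass hp') (_halg : hp' ∈ algebraicClasses X p) (_hm : 0 < m)
    (_ha : ∀ k, (a k : ℝ) ≤ C * (k : ℝ) ^ p)
    (_ht : Filter.Tendsto (fun k : ℕ => t k * (k : ℝ) ^ p) Filter.atTop (nhds 0))
    (_hfreq : ∃ᶠ k : ℕ in Filter.atTop, ∃ S Sg : Set A.carrier, (IsClosed S ∧ IsClosed Sg ∧ Sg ⊆ S ∧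
      IsConnected (S \ Sg) ∧
      (∀ x ∈ Sg, Literature.Geometry.Kaehler.IsAnalyticSetAt 𝓘(ℂ, A.model) S x) ∧
      (∃ T : Set A.carrier, Sg ⊆ T ∧ (Literature.Geometry.Kaehler.IsAnalyticSet 𝓘(ℂ, A.model) T ∧
        ∀ x ∈ Literature.Geometry.Kaehler.regularLocus 𝓘(ℂ, A.model) T, ∀ q : ℕ,
          Literature.Geometry.Kaehler.IsRegularPointOfCodim 𝓘(ℂ, A.model) T q x → p + 1 ≤ q)) ∧
      (∀ x ∈ S \ Sg, ∃ U : Set A.carrier, IsOpen U ∧ x ∈ U ∧ ∃ f : A.carrier → (Fin (2 * p) → ℝ),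
        ContMDiffOn 𝓘(ℝ, A.model) 𝓘(ℝ, Fin (2 * p) → ℝ) 1 f U ∧ S ∩ U = U ∩ f ⁻¹' {0} ∧
        Function.Surjective (mfderiv 𝓘(ℝ, A.model) 𝓘(ℝ, Fin (2 * p) → ℝ) f x) ∧
        ∀ v : TangentSpace 𝓘(ℝ, A.model) x, mfderiv 𝓘(ℝ, A.model) 𝓘(ℝ, Fin (2 * p) → ℝ) f x v = 0 →
          ∃ w : TangentSpace 𝓘(ℝ, A.model) x,
            mfderiv 𝓘(ℝ, A.model) 𝓘(ℝ, Fin (2 * p) → ℝ) f x w = 0 ∧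
            g.inner x (Literature.Geometry.Kaehler.tangentJ A.model x v - w)
              (Literature.Geometry.Kaehler.tangentJ A.model x v - w) ≤ (t k) ^ 2 * g.inner x v v)) ∧
      Literature.AlgebraicTopology.SingularHomology.singularCohomology.map ℂ ℂ
        (⟨Subtype.val, continuous_subtype_val⟩ : C({x : A.carrier // x ∉ S}, A.carrier)) (2 * p)
        (A.pullback (2 * p) (((m : ℂ) • c + ((a k : ℕ) : ℂ) • hp'))) = 0) :
    A.pullback (2 * p) c ∈ A.hodgePQ (2 * p) p p :=
  pullback_mem_hodgePQ_of_eq_zero_or_eq A (by omega) c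

end Summit.HodgeConjecture.HodgeConjecture.Theorems
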